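import Summits.CriticalPhenomena.PercolationContinuityZ3.Theorems.PercNearOneGluingNoHeavyQuantDepthOneRows
import Summits.CriticalPhenomena.PercolationContinuityZ3.Theorems.PercNearOneGluingNoHeavyQuantPhantomRelay
import Summits.CriticalPhenomena.PercolationContinuityZ3.Theorems.PercNearOneGluingNoHeavyQuantFlowUncross
import Summits.CriticalPhenomena.PercolationContinuityZ3.Theorems.PercNearOneGluingNoHeavyQuantSliceTwoRowRates
import HarnessLib

/-!
# QUANT lane R8, depth-2 closure (D2) in the RELAY case: THE NEW-TOP-LOW ROWS — the `LawDec.TLC` rows `(j, k+1)` of (relay_g) ∗ μ at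
# target `T + g` whose threshold `k + 1` is a product low but NOT a factor low (`T ≤ 2(k+1) < T + g`), from ONE factor single-threshold row

builds on p205010 (kernel theorem, internal audit signed; external expert review pending)

Support file (`--supports stmt-CriticalPhenomena-4575`), QUANT lane seat prim-quant-arm-2 (gen 39), rung R8 of
`run/shared/lean/prim/quant/LADDER.md`; lane pointer `run/shared/lean/prim/quant/FOR-PROVERS-D2-RELAY.md` §2 (b) / §3 (2) (census-2 g67:
"'new top lows' `T ≤ 2i′ < T+g`: ONE scaled single-threshold row at threshold `i′ − 1`").  Theorems only, standard axioms, no sorries.  Companion of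
`…QuantDepthTwoRelayTilt` (this seat: the top-layer non-cheap rows) and of census-2 g67's one-row lemma (`…QuantDepthTwoRelayRow{Pointwise,,Zero}`:
every old threshold `2i < T`).

SETTING (q = 1 relay case of D2 / G₁).  `μ ≥ 0` on `{0..M}`, floor `0 < y < 1`, `u = y/(1−y)`, target `T`; partner `{0: 1−g, 1: g}`, `y ≤ g ≤ 1`;
product `ν = lconv M 1 μ {0:1−g,1:g}` on `{0..M+1}` at target `T + g`.  Raising the target by `g` creates at most one NEW product low: the threshold
`k + 1` with `T ≤ 2(k+1) < T + g`.  The factor cannot price the atom `k + 1`, but it need not: in the pull-back `e(a) = (1−g)C′(a) + gC′(a+1)` of the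
product row `(j, k+1)`, `e(k+1) = (1−g)u − g·u/usage′(k+1, k+2) ≤ 0` because the pair `(k+1, k+2)` at `T + g` has `ρ = T + g − 2k − 2 ≤ g`, so
its minimal gate is `≤ g` and `g/usage′ ≥ 1 − g`.  Hence ONE factor row with weight one suffices (arm-2 g39 exact census `code/newtop*.py`: 53 801
such rows on the lane grid, 0 exceptions to the trichotomy below):

  `relayConv_tlcRowNewTop_functional`: `TLC y T M μ`, `μ ≥ 0`, `1 ≤ k+1 ≤ j ≤ M`, `T ≤ 2(k+1) < T + g`, and the layer case of census-2's lemma —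
  (`j < M` and the pair `(k+1, j)` is not a cheap mid at `T + g`: `T+g < k+1+j → u ≤ usage′`)  or  (`(k+1, j)` is a compatible cheap mid:
  `T+g < k+1+j`, `usage′ ≤ u`) — ⟹ the `LawDec.TLC` row `(j, k+1)` of `ν` at `(y, T+g, M+1)` in functional form `Σ_h C′(h)·ν(h) ≤ 0` (the input of
  census-2's bridge `tlcRow_of_functional`).  Certificate: the factor row `TLCR_T(j*, k)`, `j* = j` (first case) / `j − 1` (cheap case), weight `1`.

POINTWISE (`relay_newTop_pointwise`): lows `a ≤ k` cost `u` on both sides; `a = k+1` costs `≤ 0` (above); a mid `a` of the product between `k+1`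
and `j` is charged `(1−g)/usage′(k+1,a) + g/usage′(k+1,a+1) ≥ 1/usage_T(k, a)` because both product pairs have a smaller `ρ` than the factor pair
`(k, a)` (`ρ′ = c/(a−k−1)`, `c/(a−k)` with `c = T+g−2k−2 ≤ g` against `(c − g + 2)/(a − k)`; `pairGate` is monotone in `ρ`, `pairGate_mono_rho`); at
`a = j` the not-cheap hypothesis (`u/usage′ ≤ 1`) resp. the cheap one (`u/usage′ ≥ 1`, factor giant) closes; giants match.  The remaining top rows
(`j = M`, top pair not cheap) are `…QuantDepthTwoRelayTilt`'s.  HONEST STATUS: one more row family of the relay case of D2 / G₁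
(`LawDec.TLC2GateConvTLC`) is a theorem; D2, G₁, SGC, `Quant.FarTreeRow` (light) remain OPEN; nothing here is cited as a published result; the lane's
RATE class log\* and honest sentence (`…/prim/quant/README.md`) are unchanged.

[this work]; one-row lemma and census: prim-quant-census-2 g67; `sum_fun_mul_lconv_one`: prim-quant-lead g38; usage / pairGate / `pairGate_mono_rho`:
prim-quant-stmt g22, prim-quant-census-2 g54 (this lane).  The gluing rows served [cite: KozmaNitzan2024, Conjecture 3 (p. 15)]; product measure
[cite: Grimmett1999, §1.3 p. 10].
-/


noncomputable section

namespace Summit.CriticalPhenomena.PercolationContinuityZ3.Theorems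

namespace Quant

open Finset

namespace LawDec

/-! ### Rate bookkeeping -/

/-- `1/usage` of a compatible pair is nonnegative (`2l < τ < l + h`, `0 < y < 1`; any layer). [this work] -/
theorem one_div_usage_nonneg_of_compat (y τ : ℝ) (j l h : ℕ) (hy0 : 0 < y) (hy1 : y < 1)
    (hlow : 2 * (l : ℝ) < τ) (hcomp : τ < (l : ℝ) + h) : 0 ≤ 1 / usage y τ j l h := by
  have hlh : l < h := by
    have : (l : ℝ) < h := by linarith
    exact_mod_cast this
  rcases le_or_gt h j with hh | hh
  · exact (one_div_pos.2 (usage_pos_of_compat y τ j l h hy0 hy1 hlow hlh (Or.inr hcomp))).le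
  · exact (one_div_pos.2 (usage_pos_of_compat y τ j l h hy0 hy1 hlow hlh (Or.inl (by omega)))).le

/-- **`1/usage` is antitone in the minimal gate** (pairs below their layers): `h₁ ≤ j₁`, `h₂ ≤ j₂`, the first pair priced (`2l₁ < τ₁`, `l₁ < h₁`),
the second a genuine compatible low pair (`2l₂ < τ₂ < l₂ + h₂`), `0 < y < 1`, `pairGate y τ₁ l₁ h₁ ≤ pairGate y τ₂ l₂ h₂` ⟹
`1/usage y τ₂ j₂ l₂ h₂ ≤ 1/usage y τ₁ j₁ l₁ h₁`. [this work] -/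
theorem one_div_usage_anti (y τ₁ τ₂ : ℝ) (j₁ l₁ h₁ j₂ l₂ h₂ : ℕ) (hy0 : 0 < y) (hy1 : y < 1)
    (hh₁ : h₁ ≤ j₁) (hh₂ : h₂ ≤ j₂) (hlow₁ : 2 * (l₁ : ℝ) < τ₁) (hlh₁ : l₁ < h₁)
    (hlow₂ : 2 * (l₂ : ℝ) < τ₂) (hcomp₂ : τ₂ < (l₂ : ℝ) + h₂)
    (hG : pairGate y τ₁ l₁ h₁ ≤ pairGate y τ₂ l₂ h₂) :
    1 / usage y τ₂ j₂ l₂ h₂ ≤ 1 / usage y τ₁ j₁ l₁ h₁ := by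
  have hn1 : ¬ (j₁ + 1 ≤ h₁) := by omega
  have hn2 : ¬ (j₂ + 1 ≤ h₂) := by omega
  simp only [usage, gateOf, if_neg hn1, if_neg hn2]
  have hG1 : 0 < pairGate y τ₁ l₁ h₁ := pairGate_pos y τ₁ l₁ h₁ hlow₁ hlh₁
  have hG2 : pairGate y τ₂ l₂ h₂ < 1 := pairGate_lt_one y τ₂ l₂ h₂ hy0 hy1 hlow₂ hcomp₂
  have hG2' : 0 < pairGate y τ₂ l₂ h₂ := lt_of_lt_of_le hG1 hG
  rw [one_div_div, one_div_div, div_le_div_iff₀ hG2' hG1]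
  nlinarith

/-- real arithmetic: the `ρ` of the product pair `(k+1, b)` at `T + g` is at most the `ρ` of the factor pair `(k, b)` at `T`
(`T ≤ 2(k+1)`, `g ≤ 1`, `b ≥ k + 2`). [this work] -/
theorem rho_newTop_le (T g κ b : ℝ) (hg1 : g ≤ 1) (htop : T ≤ 2 * (κ + 1)) (hb : κ + 2 ≤ b) :
    (T + g - 2 * (κ + 1)) / (b - (κ + 1)) ≤ (T - 2 * κ) / (b - κ) := by
  rw [div_le_div_iff₀ (by linarith) (by linarith)]
  have h : (2 : ℝ) ≤ (2 - g) * (b - κ) := by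
    nlinarith [mul_nonneg (show (0 : ℝ) ≤ 1 - g by linarith) (show (0 : ℝ) ≤ b - κ - 2 by linarith)]
  nlinarith [h]

/-- real arithmetic: the `ρ` of the shifted product pair `(k+1, b+1)` at `T + g` is at most the `ρ` of the factor pair `(k, b)` at `T`
(`g ≤ 2`, `b > k`). [this work] -/
theorem rho_newTop_shift_le (T g κ b : ℝ) (hg1 : g ≤ 1) (hb : κ < b) :
    (T + g - 2 * (κ + 1)) / (b + 1 - (κ + 1)) ≤ (T - 2 * κ) / (b - κ) := by
  rw [show b + 1 - (κ + 1) = b - κ by ring, div_le_div_iff₀ (by linarith) (by linarith)]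
  nlinarith [show (0 : ℝ) < b - κ by linarith]

/-- **the new-low cell**: `T ≤ 2(k+1) < T + g`, `y ≤ g ≤ 1`, `k + 2 ≤ j` ⟹ the product pair `(k+1, k+2)` at `T + g` (whose `ρ` is `T + g − 2k − 2 ≤ g`)
has `g/usage ≥ 1 − g`. [this work] -/
theorem relay_newTop_cell (y T g : ℝ) (k j : ℕ) (hy0 : 0 < y) (hy1 : y < 1) (hyg : y ≤ g)
    (htop : T ≤ 2 * ((k : ℝ) + 1)) (hlow : 2 * ((k : ℝ) + 1) < T + g) (hkj : k + 2 ≤ j) :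
    1 - g ≤ g * (1 / usage y (T + g) j (k + 1) (k + 2)) := by
  have hn : ¬ (j + 1 ≤ k + 2) := by omega
  simp only [usage, gateOf, if_neg hn]
  have hlow' : 2 * (((k + 1 : ℕ) : ℝ)) < T + g := by push_cast; linarith
  have hGpos : 0 < pairGate y (T + g) (k + 1) (k + 2) := pairGate_pos y (T + g) (k + 1) (k + 2) hlow' (by omega)
  have hGg : pairGate y (T + g) (k + 1) (k + 2) ≤ g := by
    unfold pairGate
    have e : (T + g - 2 * (((k + 1 : ℕ) : ℝ))) / ((((k + 2 : ℕ) : ℝ)) - ((k + 1 : ℕ) : ℝ)) = T + g - 2 * ((k : ℝ) + 1) := by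
      push_cast; ring
    rw [e]
    calc max (T + g - 2 * ((k : ℝ) + 1)) (y ^ 2 + (1 - y) * (T + g - 2 * ((k : ℝ) + 1)))
        ≤ max g (y ^ 2 + (1 - y) * g) := gateFun_mono hy1.le (by linarith)
      _ = g := max_eq_left (by nlinarith [mul_nonneg hy0.le (sub_nonneg.2 hyg)])
  rw [one_div_div, mul_div_assoc', le_div_iff₀ hGpos]
  nlinarith

/-! ### The certificate, pointwise -/

/-- **NEW TOP LOW, POINTWISE.**  `0 < y < 1`, `u = y/(1−y)`, `y ≤ g ≤ 1`; a product threshold `k + 1 ≤ j ≤ M` with `T ≤ 2(k+1) < T + g`; a factor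
layer `j*` given by the layer case (`j* = j < M` and `(k+1, j)` not a cheap mid at `T + g`, or `j* + 1 = j` and `(k+1, j)` a compatible cheap mid).
With `C′` the coefficients of the product `LawDec.TLC` row `(j, k+1)` at `(y, T + g)` on `{0..M+1}` and `C` those of the factor row `(j*, k)` at
`(y, T)`: for every atom `a ≤ M`, `(1−g)·C′(a) + g·C′(a+1) ≤ C(a)`. [this work] -/
theorem relay_newTop_pointwise (y T g u : ℝ) (k j js M : ℕ) (Cp Cf : ℕ → ℝ)
    (hy0 : 0 < y) (hy1 : y < 1) (hu : u = y / (1 - y)) (hyg : y ≤ g) (hg1 : g ≤ 1)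
    (htop : T ≤ 2 * ((k : ℝ) + 1)) (hlow : 2 * ((k : ℝ) + 1) < T + g) (hkj : k + 1 ≤ j) (hjM : j ≤ M)
    (hjs : (js = j ∧ j < M ∧ (T + g < ((k + 1 : ℕ) : ℝ) + j → u ≤ usage y (T + g) j (k + 1) j))
      ∨ (js + 1 = j ∧ T + g < ((k + 1 : ℕ) : ℝ) + j ∧ usage y (T + g) j (k + 1) j ≤ u))
    (hCp : ∀ h : ℕ, Cp h = u * (if h ≤ k + 1 then (1 : ℝ) else 0) - (if j + 1 ≤ h then (1 : ℝ) else 0)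
      - u * (if h ≤ j ∧ T + g < ((k + 1 : ℕ) : ℝ) + h then 1 / usage y (T + g) j (k + 1) h else 0))
    (hCf : ∀ a : ℕ, Cf a = u * (if a ≤ k then (1 : ℝ) else 0) - (if js + 1 ≤ a then (1 : ℝ) else 0)
      - u * (if a ≤ js ∧ T < (k : ℝ) + a then 1 / usage y T js k a else 0))
    (a : ℕ) (ha : a ≤ M) :
    (1 - g) * Cp a + g * Cp (a + 1) ≤ Cf a := by
  have h1y : 0 < 1 - y := by linarith
  have hu0 : 0 < u := by rw [hu]; exact div_pos hy0 h1y
  have hg0 : 0 < g := lt_of_lt_of_le hy0 hyg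
  have hk0 : (0 : ℝ) ≤ k := Nat.cast_nonneg k
  have hlowk : 2 * (k : ℝ) < T := by linarith
  have hlow' : 2 * (((k + 1 : ℕ) : ℝ)) < T + g := by push_cast; linarith
  have hjs_le : js ≤ j := by rcases hjs with ⟨h, _⟩ | ⟨h, _⟩ <;> omega
  have hjs_ge : j ≤ js + 1 := by rcases hjs with ⟨h, _⟩ | ⟨h, _⟩ <;> omega
  have hjsk : k + 1 ≤ js := by
    rcases hjs with ⟨h, _⟩ | ⟨h, hc, _⟩
    · omega
    · by_contra hlt
      have hjk : j = k + 1 := by omega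
      rw [hjk] at hc; push_cast at hc; linarith
  have hgu : (1 - g) * u ≤ g := by
    rw [hu, mul_div_assoc', div_le_iff₀ h1y]; linarith
  have hinvP : ∀ h : ℕ, T + g < ((k + 1 : ℕ) : ℝ) + h → 0 ≤ 1 / usage y (T + g) j (k + 1) h :=
    fun h hc => one_div_usage_nonneg_of_compat y (T + g) j (k + 1) h hy0 hy1 hlow' hc
  rcases Nat.lt_or_ge a (k + 1) with hak | hka
  · ---- (1) a deep low `a ≤ k`: `u` on both sides
    have hak' : (a : ℝ) ≤ k := by exact_mod_cast Nat.lt_succ_iff.1 hak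
    have e1 : Cp a = u := by
      rw [hCp a, if_pos hak.le, if_neg (by omega), if_neg (fun h => by push_cast at h; linarith [h.2])]; ring
    have e2 : Cp (a + 1) = u := by
      rw [hCp (a + 1), if_pos (by omega), if_neg (by omega), if_neg (fun h => by push_cast at h; linarith [h.2])]; ring
    have ef : Cf a = u := by
      rw [hCf a, if_pos (by omega), if_neg (by omega), if_neg (fun h => by linarith [h.2])]; ring
    rw [e1, e2, ef]; linarith
  rcases hka.eq_or_lt with hka' | hka'
  · ---- (2) `a = k + 1`, the new top low: `e ≤ 0 = C(k+1)`
    subst hka'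
    have e1 : Cp (k + 1) = u := by
      rw [hCp (k + 1), if_pos le_rfl, if_neg (by omega), if_neg (fun h => by push_cast at h; linarith [h.2])]; ring
    have ef : Cf (k + 1) = 0 := by
      rw [hCf (k + 1), if_neg (by omega), if_neg (by omega), if_neg (fun h => by push_cast at h; linarith [h.2])]; ring
    rw [e1, ef]
    rcases hkj.eq_or_lt with hkj' | hkj'
    · -- `j = k + 1`: the next atom is the product giant
      have e2 : Cp (k + 1 + 1) = -1 := by
        rw [hCp (k + 1 + 1), if_neg (by omega), if_pos (by omega), if_neg (fun h => by omega)]; ring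
      rw [e2]; linarith
    · by_cases hc2 : T + g < ((k + 1 : ℕ) : ℝ) + ((k + 1 + 1 : ℕ) : ℝ)
      · -- the cheap cell `(k+1, k+2)`
        have e2 : Cp (k + 1 + 1) = -(u * (1 / usage y (T + g) j (k + 1) (k + 2))) := by
          rw [hCp (k + 1 + 1), if_neg (by omega), if_neg (by omega), if_pos ⟨by omega, hc2⟩]; ring
        rw [e2]
        have hcell := relay_newTop_cell y T g k j hy0 hy1 hyg htop hlow (by omega)
        linarith [mul_le_mul_of_nonneg_left hcell hu0.le]
      · -- not compatible: then `g = 1`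
        have e2 : Cp (k + 1 + 1) = 0 := by
          rw [hCp (k + 1 + 1), if_neg (by omega), if_neg (by omega), if_neg (fun h => hc2 h.2)]; ring
        rw [e2]
        have hc2' := not_lt.1 hc2
        push_cast at hc2'
        have hg1' : 1 ≤ g := by linarith
        have := mul_le_mul_of_nonneg_right (show 1 - g ≤ 0 by linarith) hu0.le
        linarith
  ---- `k + 2 ≤ a`
  have hka2 : (k : ℝ) + 2 ≤ a := by exact_mod_cast hka'
  rcases lt_trichotomy a j with haj | haj | haj
  · ---- (3) a mid strictly below the product layer: `a + 1 ≤ j`, `a ≤ j*`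
    have e1 : Cp a = -(u * (if a ≤ j ∧ T + g < ((k + 1 : ℕ) : ℝ) + a then 1 / usage y (T + g) j (k + 1) a else 0)) := by
      rw [hCp a, if_neg (by omega), if_neg (by omega)]; ring
    have e2 : Cp (a + 1) = -(u * (if a + 1 ≤ j ∧ T + g < ((k + 1 : ℕ) : ℝ) + ((a + 1 : ℕ) : ℝ) then
        1 / usage y (T + g) j (k + 1) (a + 1) else 0)) := by
      rw [hCp (a + 1), if_neg (by omega), if_neg (by omega)]; ring
    have ef : Cf a = -(u * (if a ≤ js ∧ T < (k : ℝ) + a then 1 / usage y T js k a else 0)) := by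
      rw [hCf a, if_neg (by omega), if_neg (by omega)]; ring
    rw [e1, e2, ef]
    by_cases hcf : T < (k : ℝ) + a
    · -- the factor pair `(k, a)` is compatible: both product pairs dominate it
      have hcp : T + g < ((k + 1 : ℕ) : ℝ) + a := by push_cast; linarith
      have hcp1 : T + g < ((k + 1 : ℕ) : ℝ) + ((a + 1 : ℕ) : ℝ) := by push_cast; linarith
      rw [if_pos ⟨haj.le, hcp⟩, if_pos ⟨haj, hcp1⟩, if_pos ⟨by omega, hcf⟩]
      have hG1 : pairGate y (T + g) (k + 1) a ≤ pairGate y T k a :=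
        pairGate_mono_rho y (T + g) T (k + 1) a k a hy1.le (by push_cast; exact rho_newTop_le T g k a hg1 htop hka2)
      have hG2 : pairGate y (T + g) (k + 1) (a + 1) ≤ pairGate y T k a :=
        pairGate_mono_rho y (T + g) T (k + 1) (a + 1) k a hy1.le (by push_cast; exact rho_newTop_shift_le T g k a hg1 (by linarith))
      have h1 := one_div_usage_anti y (T + g) T j (k + 1) a js k a hy0 hy1 haj.le (by omega) hlow' (by omega) hlowk hcf hG1
      have h2 := one_div_usage_anti y (T + g) T j (k + 1) (a + 1) js k a hy0 hy1 haj (by omega) hlow' (by omega) hlowk hcf hG2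
      linarith [mul_le_mul_of_nonneg_left h1 (mul_nonneg (sub_nonneg.2 hg1) hu0.le),
        mul_le_mul_of_nonneg_left h2 (mul_nonneg hg0.le hu0.le)]
    · rw [if_neg (show ¬ (a ≤ js ∧ T < (k : ℝ) + a) from fun h => hcf h.2)]
      have t1 : 0 ≤ (if a ≤ j ∧ T + g < ((k + 1 : ℕ) : ℝ) + a then 1 / usage y (T + g) j (k + 1) a else 0) := by
        split_ifs with h
        · exact hinvP a h.2
        · exact le_rfl
      have t2 : 0 ≤ (if a + 1 ≤ j ∧ T + g < ((k + 1 : ℕ) : ℝ) + ((a + 1 : ℕ) : ℝ) then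
          1 / usage y (T + g) j (k + 1) (a + 1) else 0) := by
        split_ifs with h
        · exact hinvP (a + 1) h.2
        · exact le_rfl
      linarith [mul_nonneg (sub_nonneg.2 hg1) (mul_nonneg hu0.le t1), mul_nonneg hg0.le (mul_nonneg hu0.le t2)]
  · ---- (4) `a = j`, the top of the product layer
    subst haj
    have e1 : Cp a = -(u * (if a ≤ a ∧ T + g < ((k + 1 : ℕ) : ℝ) + a then 1 / usage y (T + g) a (k + 1) a else 0)) := by
      rw [hCp a, if_neg (by omega), if_neg (by omega)]; ring
    have e2 : Cp (a + 1) = -1 := by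
      rw [hCp (a + 1), if_neg (by omega), if_pos le_rfl, if_neg (fun h => by omega)]; ring
    rw [e1, e2]
    rcases hjs with ⟨hjsj, _, hexp⟩ | ⟨hjsj, hcomp, hcheap⟩
    · -- same layer: `j* = j`
      subst hjsj
      have ef : Cf js = -(u * (if js ≤ js ∧ T < (k : ℝ) + js then 1 / usage y T js k js else 0)) := by
        rw [hCf js, if_neg (by omega), if_neg (by omega)]; ring
      rw [ef]
      by_cases hcf : T < (k : ℝ) + js
      · have hcp : T + g < ((k + 1 : ℕ) : ℝ) + js := by push_cast; linarith
        rw [if_pos ⟨le_rfl, hcp⟩, if_pos ⟨le_rfl, hcf⟩]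
        have hG1 : pairGate y (T + g) (k + 1) js ≤ pairGate y T k js :=
          pairGate_mono_rho y (T + g) T (k + 1) js k js hy1.le (by push_cast; exact rho_newTop_le T g k js hg1 htop hka2)
        have h1 := one_div_usage_anti y (T + g) T js (k + 1) js js k js hy0 hy1 le_rfl le_rfl hlow' (by omega) hlowk hcf hG1
        have hpos : 0 < usage y (T + g) js (k + 1) js :=
          usage_pos_of_compat y (T + g) js (k + 1) js hy0 hy1 hlow' (by omega) (Or.inr hcp)
        have h2 : u * (1 / usage y (T + g) js (k + 1) js) ≤ 1 := by
          rw [← div_eq_mul_one_div, div_le_one hpos]; exact hexp hcp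
        linarith [mul_le_mul_of_nonneg_left h1 hu0.le, mul_le_mul_of_nonneg_left h2 hg0.le]
      · rw [if_neg (show ¬ (js ≤ js ∧ T < (k : ℝ) + js) from fun h => hcf h.2)]
        have t1 : 0 ≤ (if js ≤ js ∧ T + g < ((k + 1 : ℕ) : ℝ) + js then 1 / usage y (T + g) js (k + 1) js else 0) := by
          split_ifs with h
          · exact hinvP js h.2
          · exact le_rfl
        linarith [mul_nonneg (sub_nonneg.2 hg1) (mul_nonneg hu0.le t1)]
    · -- lower layer: `j* + 1 = j`, the top atom is a factor giant and the pair is cheap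
      have ef : Cf a = -1 := by
        rw [hCf a, if_neg (by omega), if_pos (by omega), if_neg (fun h => by omega)]; ring
      rw [ef, if_pos ⟨le_rfl, hcomp⟩]
      have hpos : 0 < usage y (T + g) a (k + 1) a :=
        usage_pos_of_compat y (T + g) a (k + 1) a hy0 hy1 hlow' (by omega) (Or.inr hcomp)
      have h3 : 1 ≤ u * (1 / usage y (T + g) a (k + 1) a) := by
        rw [← div_eq_mul_one_div, le_div_iff₀ hpos]; linarith
      linarith [mul_le_mul_of_nonneg_left h3 (sub_nonneg.2 hg1)]
  · ---- (5) above the product layer: giants on both sides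
    have e1 : Cp a = -1 := by
      rw [hCp a, if_neg (by omega), if_pos (by omega), if_neg (fun h => by omega)]; ring
    have e2 : Cp (a + 1) = -1 := by
      rw [hCp (a + 1), if_neg (by omega), if_pos (by omega), if_neg (fun h => by omega)]; ring
    have ef : Cf a = -1 := by
      rw [hCf a, if_neg (by omega), if_pos (by omega), if_neg (fun h => by omega)]; ring
    rw [e1, e2, ef]; linarith

/-! ### The row, functional form -/

/-- **a `LawDec.TLC` row in functional form**: `TLC y T M μ`, `j* < M`, `i′ ≤ j*`, `2i′ < T` ⟹
`Σ_{a ≤ M} μ a · (u[a ≤ i′] − [j*+1 ≤ a] − u[a ≤ j* ∧ T < i′+a]/usage y T j* i′ a) ≤ 0`. [this work] -/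
theorem tlcRow_functional_of_tlc (y T : ℝ) (M js i' : ℕ) (μ : ℕ → ℝ) (hT1 : TLC y T M μ)
    (hjs : js < M) (hi : i' ≤ js) (hlow : 2 * (i' : ℝ) < T) :
    ∑ a ∈ Finset.range (M + 1), μ a * (y / (1 - y) * (if a ≤ i' then (1 : ℝ) else 0) - (if js + 1 ≤ a then (1 : ℝ) else 0)
      - y / (1 - y) * (if a ≤ js ∧ T < (i' : ℝ) + a then 1 / usage y T js i' a else 0)) ≤ 0 := by
  have row := hT1 js i' hjs hi hlow
  have e1 : ∑ a ∈ Finset.range (M + 1), μ a * (y / (1 - y) * (if a ≤ i' then (1 : ℝ) else 0))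
      = y / (1 - y) * ∑ l ∈ Finset.range (i' + 1), μ l := by
    rw [← Finset.sum_range_add_sum_Ico _ (show i' + 1 ≤ M + 1 by omega), Finset.mul_sum]
    have h2 : ∑ h ∈ Finset.Ico (i' + 1) (M + 1), μ h * (y / (1 - y) * (if h ≤ i' then (1 : ℝ) else 0)) = 0 :=
      Finset.sum_eq_zero fun h hh => by rw [Finset.mem_Ico] at hh; rw [if_neg (by omega)]; ring
    rw [h2, add_zero]
    exact Finset.sum_congr rfl fun a ha => by rw [Finset.mem_range] at ha; rw [if_pos (by omega)]; ring
  have e3 : ∑ a ∈ Finset.range (M + 1), μ a * (if js + 1 ≤ a then (1 : ℝ) else 0)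
      = ∑ h ∈ Finset.range (M + 1), (if js + 1 ≤ h then μ h else 0) :=
    Finset.sum_congr rfl fun a _ => by split_ifs <;> ring
  have e4 : ∑ a ∈ Finset.range (M + 1), μ a * (y / (1 - y) * (if a ≤ js ∧ T < (i' : ℝ) + a then 1 / usage y T js i' a else 0))
      = y / (1 - y) * ∑ h ∈ Finset.range (M + 1), (if h ≤ js ∧ T < (i' : ℝ) + h then μ h / usage y T js i' h else 0) := by
    rw [Finset.mul_sum]
    exact Finset.sum_congr rfl fun a _ => by split_ifs <;> ring
  have hsplit : ∑ a ∈ Finset.range (M + 1), μ a * (y / (1 - y) * (if a ≤ i' then (1 : ℝ) else 0) - (if js + 1 ≤ a then (1 : ℝ) else 0)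
      - y / (1 - y) * (if a ≤ js ∧ T < (i' : ℝ) + a then 1 / usage y T js i' a else 0))
      = ∑ a ∈ Finset.range (M + 1), μ a * (y / (1 - y) * (if a ≤ i' then (1 : ℝ) else 0))
        - ∑ a ∈ Finset.range (M + 1), μ a * (if js + 1 ≤ a then (1 : ℝ) else 0)
        - ∑ a ∈ Finset.range (M + 1), μ a * (y / (1 - y) * (if a ≤ js ∧ T < (i' : ℝ) + a then 1 / usage y T js i' a else 0)) := by
    rw [← Finset.sum_sub_distrib, ← Finset.sum_sub_distrib]
    exact Finset.sum_congr rfl fun a _ => by ring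
  rw [hsplit, e1, e3, e4]
  linarith [row]

/-- **THE NEW-TOP-LOW ROWS OF THE RELAY PRODUCT (functional form).**  `0 < y < 1`, `y ≤ g ≤ 1`; `μ ≥ 0` with `TLC y T M μ` (census-2 g64's
single-threshold family); a product threshold `k + 1` with `T ≤ 2(k+1) < T + g` (the new top low) and a product layer `k + 1 ≤ j ≤ M` in the
layer case of census-2 g67's one-row lemma (`j < M` and `(k+1, j)` not a cheap mid at `T + g`, or `(k+1, j)` a compatible cheap mid).  Then for
`ν = lconv M 1 μ {0: 1−g, 1: g}`: `Σ_{h ≤ M+1} C′(h)·ν(h) ≤ 0` with `C′` the coefficients of the `LawDec.TLC` row `(j, k+1)` at `(y, T + g)` on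
`{0..M+1}` — the hypothesis of census-2's bridge `tlcRow_of_functional`.  Certificate: ONE factor row `TLCR_T(j*, k)`, weight one. [this work] -/
theorem relayConv_tlcRowNewTop_functional (y T g : ℝ) (M k j : ℕ) (μ : ℕ → ℝ)
    (hy0 : 0 < y) (hy1 : y < 1) (hyg : y ≤ g) (hg1 : g ≤ 1) (hμ0 : ∀ h, 0 ≤ μ h) (hT1 : TLC y T M μ)
    (htop : T ≤ 2 * ((k : ℝ) + 1)) (hlow : 2 * ((k : ℝ) + 1) < T + g) (hkj : k + 1 ≤ j) (hjM : j ≤ M)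
    (hcase : (j < M ∧ (T + g < ((k + 1 : ℕ) : ℝ) + j → y / (1 - y) ≤ usage y (T + g) j (k + 1) j))
      ∨ (T + g < ((k + 1 : ℕ) : ℝ) + j ∧ usage y (T + g) j (k + 1) j ≤ y / (1 - y))) :
    ∑ h ∈ Finset.range (M + 1 + 1), (y / (1 - y) * (if h ≤ k + 1 then (1 : ℝ) else 0) - (if j + 1 ≤ h then (1 : ℝ) else 0)
      - y / (1 - y) * (if h ≤ j ∧ T + g < ((k + 1 : ℕ) : ℝ) + h then 1 / usage y (T + g) j (k + 1) h else 0))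
        * lconv M 1 μ (fun h => if h = 1 then g else if h = 0 then 1 - g else 0) h ≤ 0 := by
  -- the factor layer `j*`
  have hjs : ∃ js : ℕ, js < M ∧ k ≤ js ∧
      ((js = j ∧ j < M ∧ (T + g < ((k + 1 : ℕ) : ℝ) + j → y / (1 - y) ≤ usage y (T + g) j (k + 1) j))
        ∨ (js + 1 = j ∧ T + g < ((k + 1 : ℕ) : ℝ) + j ∧ usage y (T + g) j (k + 1) j ≤ y / (1 - y))) := by
    rcases hcase with ⟨hjM', hexp⟩ | ⟨hcomp, hcheap⟩
    · exact ⟨j, hjM', by omega, Or.inl ⟨rfl, hjM', hexp⟩⟩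
    · exact ⟨j - 1, by omega, by omega, Or.inr ⟨by omega, hcomp, hcheap⟩⟩
  obtain ⟨js, hjsM, hkjs, hjs⟩ := hjs
  set Cp : ℕ → ℝ := fun h => y / (1 - y) * (if h ≤ k + 1 then (1 : ℝ) else 0) - (if j + 1 ≤ h then (1 : ℝ) else 0)
      - y / (1 - y) * (if h ≤ j ∧ T + g < ((k + 1 : ℕ) : ℝ) + h then 1 / usage y (T + g) j (k + 1) h else 0) with hCpdef
  set Cf : ℕ → ℝ := fun a => y / (1 - y) * (if a ≤ k then (1 : ℝ) else 0) - (if js + 1 ≤ a then (1 : ℝ) else 0)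
      - y / (1 - y) * (if a ≤ js ∧ T < (k : ℝ) + a then 1 / usage y T js k a else 0) with hCfdef
  have hCp : ∀ h : ℕ, Cp h = y / (1 - y) * (if h ≤ k + 1 then (1 : ℝ) else 0) - (if j + 1 ≤ h then (1 : ℝ) else 0)
      - y / (1 - y) * (if h ≤ j ∧ T + g < ((k + 1 : ℕ) : ℝ) + h then 1 / usage y (T + g) j (k + 1) h else 0) := fun h => rfl
  have hCf : ∀ a : ℕ, Cf a = y / (1 - y) * (if a ≤ k then (1 : ℝ) else 0) - (if js + 1 ≤ a then (1 : ℝ) else 0)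
      - y / (1 - y) * (if a ≤ js ∧ T < (k : ℝ) + a then 1 / usage y T js k a else 0) := fun a => rfl
  -- the factor row in functional form
  have hfun : ∑ a ∈ Finset.range (M + 1), μ a * Cf a ≤ 0 :=
    tlcRow_functional_of_tlc y T M js k μ hT1 hjsM hkjs (by linarith)
  -- pointwise domination and assembly
  have key : ∀ a : ℕ, a ≤ M → (1 - g) * Cp a + g * Cp (a + 1) ≤ Cf a :=
    fun a ha => relay_newTop_pointwise y T g (y / (1 - y)) k j js M Cp Cf hy0 hy1 rfl hyg hg1 htop hlow hkj hjM hjs hCp hCf a ha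
  show ∑ h ∈ Finset.range (M + 1 + 1), Cp h * lconv M 1 μ (fun h => if h = 1 then g else if h = 0 then 1 - g else 0) h ≤ 0
  rw [sum_fun_mul_lconv_one]
  simp only [show ((0 : ℕ) = 1) = False from by simp, if_true, if_false]
  calc ∑ a ∈ Finset.range (M + 1), μ a * ((1 - g) * Cp a + g * Cp (a + 1))
      ≤ ∑ a ∈ Finset.range (M + 1), μ a * Cf a :=
        Finset.sum_le_sum fun a ha => mul_le_mul_of_nonneg_left (key a (Nat.lt_succ_iff.1 (Finset.mem_range.1 ha))) (hμ0 a)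
    _ ≤ 0 := hfun

end LawDec

end Quant

end Summit.CriticalPhenomena.PercolationContinuityZ3.Theorems
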